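import Literature.MathematicalPhysics.QuantumLattice.LiebFluxPhaseRP
import Literature.MathematicalPhysics.QuantumLattice.HubbardTorusFlux
import Literature.MathematicalPhysics.QuantumLattice.FinDimSpectrumProofs
import HarnessLib

/-!
# Time reversal for Peierls–Hubbard Hamiltonians: the ground energy is even in the flux

Topic `MathematicalPhysics/QuantumLattice`; companions of `LiebFluxPhase*.lean` (Lieb's `H = K(T) + W⁰` with
complex Peierls hopping data `T σ x y` on a finite graph, `peierlsHubbard G T U`) and of `HubbardTorusFlux.lean`
(`minEnergyOn_map_conj`: sector energies are invariant under ENTRYWISE complex conjugation). Time reversal for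
spin-½ lattice fermions in a magnetic field is complex conjugation in the occupation-number basis: the
Jordan–Wigner matrices are real, so `conj H(T) = H(T^*)` (`conjTranspose_transpose_peierlsHubbard`, Lieb 1994,
p. 3, the `*` step of `Θ`), and `T ↦ T^*` REVERSES every Peierls phase, hence every plaquette flux and every
holonomy, while the spectrum is unchanged (Byers–Yang 1961: `E(−Φ) = E(Φ)`).

* `isHermitian_map_conj`, `groundEnergy_map_conj` — model-free: for Hermitian `A` on a nonempty index type,
  `E₀(conj A) = E₀(A)` (from `minEnergyOn_map_conj` on the whole space and `Matrix.minEnergyOn_top`).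
* `peierlsHubbard_map_conj` — `conj (peierlsHubbard G T U) = peierlsHubbard G T^* U` entrywise.
* `groundEnergy_peierlsHubbard_conj`, `minEnergyOn_peierlsHubbard_conj` — for Hermitian hopping data
  (`T σ y x = (T σ x y)^*`) the ground energy, and the lowest energy in every conjugation-closed sector, are the
  same for `T` and `T^*`.
* torus phases: `phaseHopping_neg` (`t e^{iθ} ↦ t e^{−iθ}` is `T ↦ T^*`), `plaquetteFlux_neg` (all plaquette
  fluxes flip), `groundEnergy_peierlsHubbardTorus_neg` — **`E₀(θ ↦ −θ) = E₀(θ)`** for every antisymmetric phase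
  function on the square torus, i.e. for EVERY flux configuration (uniform plaquette flux `B ↦ −B` included:
  Landau-gauge phases are odd in `B`). This is the first lemma FL2 («`E₀(−B) = E₀(B)`, pattern
  `fluxEnergyTT'_neg`») of the hubbard-cq card `orbital-flux-condensation-cost` at the level of Lieb's
  `peierlsHubbard`; the uniform-flux `t–t′` torus instance is a two-line corollary once that Hamiltonian is
  defined (hubbard-cq p5, FL1/D1).

References: N. Byers, C. N. Yang, Phys. Rev. Lett. 7 (1961) 46 (flux reversal / time reversal); E. H. Lieb,
Phys. Rev. Lett. 73 (1994) 2158, p. 3 (complex conjugation of `H(T)`). No definition, no named fact, no `sorry`.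
Tree search: `lean search "map_conj|fluxEnergy_neg|peierlsHubbard"` — REUSED `minEnergyOn_map_conj`,
`conjTranspose_transpose_peierlsHubbard`, `peierlsHubbard_isHermitian`, `Matrix.minEnergyOn_top_holds`; the tree
had the evenness only for the flux-THREADING tori (`fluxEnergy_neg`, `fluxEnergyTT'_neg`), not for general
Peierls data.
-/

noncomputable section

namespace Literature.MathematicalPhysics.QuantumLattice

open Matrix HubbardWave0 Literature.Probability.LatticeModels
open scoped ComplexOrder

/-! ### Model-free: the ground energy is invariant under entrywise conjugation -/

section Generic

variable {m : Type*} [Fintype m] [DecidableEq m]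

omit [Fintype m] [DecidableEq m] in
/-- The entrywise complex conjugate of a Hermitian matrix is Hermitian. [cite: Lieb1994, p. 3] -/
theorem isHermitian_map_conj {A : Matrix m m ℂ} (hA : A.IsHermitian) :
    (A.map (starRingEnd ℂ)).IsHermitian := by
  refine Matrix.IsHermitian.ext fun i j => ?_
  simp only [Matrix.map_apply]
  rw [← hA.apply i j, Complex.star_def]

/-- **`E₀(conj A) = E₀(A)`** for Hermitian `A` on a nonempty index type: time reversal (complex conjugation in a
real basis) preserves the ground energy (`minEnergyOn_map_conj` on the whole space). [cite: ByersYang1961] -/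
theorem groundEnergy_map_conj [Nonempty m] {A : Matrix m m ℂ} (hA : A.IsHermitian) :
    (A.map (starRingEnd ℂ)).groundEnergy = A.groundEnergy := by
  rw [← Matrix.minEnergyOn_top_holds hA, ← Matrix.minEnergyOn_top_holds (isHermitian_map_conj hA)]
  exact minEnergyOn_map_conj A ⊤ fun _ _ => Submodule.mem_top

end Generic

/-! ### Peierls–Hubbard Hamiltonians: `T ↦ T^*` -/

section Peierls

variable {Λ : Type*} [LinearOrder Λ] [Fintype Λ] (G : SimpleGraph Λ) [DecidableRel G.Adj]

/-- **Time reversal of `H(T)`**: `conj (peierlsHubbard G T U) = peierlsHubbard G T^* U` entrywise (the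
Jordan–Wigner matrices are real; `conjTranspose_transpose_peierlsHubbard`). [cite: Lieb1994, p. 3] -/
theorem peierlsHubbard_map_conj (T : Fin 2 → Λ → Λ → ℂ) (U : ℝ) :
    (peierlsHubbard G T U).map (starRingEnd ℂ) = peierlsHubbard G (fun σ x y => star (T σ x y)) U := by
  rw [← conjTranspose_transpose_peierlsHubbard]
  ext i j
  rw [map_apply, transpose_apply, conjTranspose_apply, Complex.star_def]

/-- **`E₀(T^*) = E₀(T)`**: for Hermitian hopping data (`T σ y x = (T σ x y)^*`) reversing every Peierls phase
leaves the ground energy of `peierlsHubbard G T U` unchanged. [cite: ByersYang1961] -/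
theorem groundEnergy_peierlsHubbard_conj (T : Fin 2 → Λ → Λ → ℂ) (hT : ∀ σ x y, T σ y x = star (T σ x y))
    (U : ℝ) :
    (peierlsHubbard G (fun σ x y => star (T σ x y)) U).groundEnergy = (peierlsHubbard G T U).groundEnergy := by
  rw [← peierlsHubbard_map_conj]
  exact groundEnergy_map_conj (peierlsHubbard_isHermitian G T hT U)

/-- Sector version: on every sector closed under complex conjugation of vectors the lowest variational energy
(`Matrix.minEnergyOn`) of `peierlsHubbard G T^* U` equals that of `peierlsHubbard G T U` (no hermiticity
needed). [cite: ByersYang1961] -/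
theorem minEnergyOn_peierlsHubbard_conj (T : Fin 2 → Λ → Λ → ℂ) (U : ℝ)
    (K : Submodule ℂ (Finset (Orb Λ) → ℂ)) (hK : ∀ ψ ∈ K, star ψ ∈ K) :
    (peierlsHubbard G (fun σ x y => star (T σ x y)) U).minEnergyOn K = (peierlsHubbard G T U).minEnergyOn K := by
  rw [← peierlsHubbard_map_conj]
  exact minEnergyOn_map_conj _ K hK

end Peierls

/-! ### The square torus: `θ ↦ −θ` reverses every flux and preserves `E₀` -/

section Torus

variable {L : ℕ} [NeZero L]

omit [NeZero L] in
/-- Negating the phase function conjugates the hopping data: `t e^{i(−θ)} = (t e^{iθ})^*`. [cite: Lieb1994, p. 3] -/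
theorem phaseHopping_neg (t : ℝ) (θ : Fin 2 → FermionTorus 2 L → FermionTorus 2 L → ℝ) :
    phaseHopping t (-θ) = fun σ x y => star (phaseHopping t θ σ x y) := by
  funext σ x y
  simp only [phaseHopping, Pi.neg_apply, Complex.ofReal_neg, Complex.star_def, map_mul, Complex.conj_ofReal,
    ← Complex.exp_conj, Complex.conj_I]
  congr 2
  ring

omit [NeZero L] in
/-- Antisymmetric phases (`θ σ y x = −θ σ x y`, Lieb's hermiticity condition `φ(x,y) = −φ(y,x)`) give Hermitian
hopping data. [cite: Lieb1994, p. 1] -/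
theorem phaseHopping_herm (t : ℝ) {θ : Fin 2 → FermionTorus 2 L → FermionTorus 2 L → ℝ}
    (hθ : ∀ σ x y, θ σ y x = -θ σ x y) (σ : Fin 2) (x y : FermionTorus 2 L) :
    phaseHopping t θ σ y x = star (phaseHopping t θ σ x y) := by
  simp only [phaseHopping, hθ σ x y, Complex.ofReal_neg, Complex.star_def, map_mul, Complex.conj_ofReal,
    ← Complex.exp_conj, Complex.conj_I]
  congr 2
  ring

/-- Negating the phases reverses EVERY plaquette flux. [cite: ByersYang1961] -/
theorem plaquetteFlux_neg (θ : Fin 2 → FermionTorus 2 L → FermionTorus 2 L → ℝ) (σ : Fin 2)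
    (x : FermionTorus 2 L) : plaquetteFlux (-θ) σ x = -plaquetteFlux θ σ x := by
  simp only [plaquetteFlux, Pi.neg_apply]
  ring

/-- `H(−θ)` is the entrywise complex conjugate of `H(θ)` on the torus. [cite: Lieb1994, p. 3] -/
theorem peierlsHubbardTorus_neg_eq_map_conj (t U : ℝ) (θ : Fin 2 → FermionTorus 2 L → FermionTorus 2 L → ℝ) :
    peierlsHubbardTorus L t U (-θ) = (peierlsHubbardTorus L t U θ).map (starRingEnd ℂ) := by
  rw [peierlsHubbardTorus, peierlsHubbardTorus, peierlsHubbard_map_conj, phaseHopping_neg]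

/-- **FL2 — the ground energy is even in the flux** (Lieb's torus Hamiltonian `peierlsHubbardTorus L t U θ`):
for every antisymmetric phase function `θ`, `E₀(−θ) = E₀(θ)`; with `plaquetteFlux_neg`, reversing all plaquette
fluxes (and all holonomies) preserves the ground energy — in particular `E₀(−B) = E₀(B)` for a uniform
plaquette flux in any gauge. [cite: ByersYang1961] -/
theorem groundEnergy_peierlsHubbardTorus_neg (t U : ℝ) {θ : Fin 2 → FermionTorus 2 L → FermionTorus 2 L → ℝ}
    (hθ : ∀ σ x y, θ σ y x = -θ σ x y) :
    (peierlsHubbardTorus L t U (-θ)).groundEnergy = (peierlsHubbardTorus L t U θ).groundEnergy := by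
  rw [peierlsHubbardTorus_neg_eq_map_conj]
  exact groundEnergy_map_conj (peierlsHubbard_isHermitian _ _ (phaseHopping_herm t hθ) U)

/-- Sector form of FL2 on the torus: in every conjugation-closed sector (e.g. the `(N, S^z)` sectors,
`star_mem_szSector`) the lowest energy is even in the phases. [cite: ByersYang1961] -/
theorem minEnergyOn_peierlsHubbardTorus_neg (t U : ℝ) (θ : Fin 2 → FermionTorus 2 L → FermionTorus 2 L → ℝ)
    (K : Submodule ℂ (Fock (Orb (FermionTorus 2 L)))) (hK : ∀ ψ ∈ K, star ψ ∈ K) :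
    (peierlsHubbardTorus L t U (-θ)).minEnergyOn K = (peierlsHubbardTorus L t U θ).minEnergyOn K := by
  rw [peierlsHubbardTorus_neg_eq_map_conj]
  exact minEnergyOn_map_conj _ K hK

/-- The `(N, S^z = M)` sector energies of the torus are even in the phases. [cite: ByersYang1961] -/
theorem minEnergyOn_szSector_peierlsHubbardTorus_neg (t U : ℝ)
    (θ : Fin 2 → FermionTorus 2 L → FermionTorus 2 L → ℝ) (N : ℕ) (M : ℝ) :
    (peierlsHubbardTorus L t U (-θ)).minEnergyOn (szSector N M) =
      (peierlsHubbardTorus L t U θ).minEnergyOn (szSector N M) :=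
  minEnergyOn_peierlsHubbardTorus_neg t U θ _ fun _ h => star_mem_szSector h

end Torus

end Literature.MathematicalPhysics.QuantumLattice

end
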